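import Summits.ResolutionOfSingularities.ResolutionOfSingularities.Theorems.IsolatedJacobianDrop.Negative.FalseWithoutMultP

/-!
# `IsolatedJacobianDrop` (crux stmt-ResolutionOfSingularities-18946, route `JacobianBudget`):
# the isolatedness hypothesis at the EARLIER stage, `Isol (run m)`, is load-bearing
# (negative-side support from the crux-disprover seat; this file does NOT refute the crux)

Companion of `FalseWithoutMultP.lean` (same directory: `crux_iff : IsolatedJacobianDrop ↔ … := Iff.rfl`
over the landed mirror calculus, and the `xy` lemmas reused here).
`isolatedJacobianDrop_false_without_Isol` proves that the right-hand side of `crux_iff` with the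
single hypothesis `Module.Finite κ (κ[[u]] ⧸ jac p (run p c₀ i t m))` (isolatedness at the EARLIER
stage) deleted, everything else verbatim, is FALSE.

Witness `(p, n, κ) = (2, 2, 𝔽₂)`, start `c₀ = x²y` — the Whitney umbrella `z² = x²y` of
`NoPeriodicIsolatedAtom/Negative/FalseWithoutIsol.lean` (`umbrella`: clean, order `3`, multiplicity
`2`, and NOT isolated: `∂(x²y) = (0, x²)` in characteristic `2`, singular all along the `y`-axis) —
but now blown up in the `x`-CHART (`y ↦ xy`), translation `0`, `m = 0`:
* `bl 0` sends `x²y ↦ x³y`, division by `x²` gives `xy`, `tr _ 0` is the identity, `xy` is clean: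
  stage 1 is the `A₁`-atom `z² = xy`, ISOLATED (`∂(xy) = (y, x)`, Jacobian algebra `κ`) of
  multiplicity `2` — an isolated successor of a non-isolated point (the `y`-axis of singularities
  leaves through the point at infinity `(0:1)` of the `x`-chart, the successor sits at `(1:0)`);
* the Jacobian algebra of `x²y` is `κ[[x,y]] ⧸ (x²)`, INFINITE over `κ` (the classes of `y^k` are
  independent: `(x²) ⊆ (x)` and `x ∣ f` kills every coefficient on `y^k`), so its `Module.finrank`
  is the junk value `0`;
* the conclusion would read `μ(xy) + Δ₂(2) ≤ finrank (κ[[x,y]] ⧸ (x²))`, i.e. `μ(xy) + 1 ≤ 0` — false.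

Reading for provers: the conservation law `Σ_{Q∈E} μ_Q + Δ_n(p) = μ_P` needs `μ_P < ∞` on the
nose — isolatedness is NOT inherited backwards along the dynamics (nor forwards), and with
`μ_P = ∞` read as `0` the budget inequality is simply false; any proof must use `Isol (run m)`.
Together with `FalseWithoutMultP` this exhausts the stage-`m` hypotheses; the stage-`(m+1)`
hypotheses are discussed in the crux work file `Cruxes/IsolatedJacobianDrop/Disproof.lean`
(`Isol (run (m+1))` is formally droppable by the junk value, `MultP (run (m+1))` enters only through
no-excess).  No definition, no notation; kernel-only.
-/

noncomputable section

-- single-problem summit: the doubled namespace component `ResolutionOfSingularities` is forced by the tree layout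
set_option linter.dupNamespace false

namespace Summit.ResolutionOfSingularities.ResolutionOfSingularities.Theorems.IsolatedJacobianDrop.Negative

open Summit.ResolutionOfSingularities.ResolutionOfSingularities.Theses.JacobianBudget (IsolatedJacobianDrop)
open Summit.ResolutionOfSingularities.ResolutionOfSingularities.Theorems.NoPeriodicIsolatedAtom.Negative
  (clean bl ord dv tr step run ser pd jac umbrella umbrella_ne_zero_iff clean_umbrella ord_umbrella
    multP_umbrella)
open scoped BigOperators Classical

/-! ## The umbrella `x²y` blown up in the `x`-chart: successor `xy` -/

/-- Blowing up in the `x`-chart (`y ↦ xy`) sends `x²y` to `x³y`. [folklore] -/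
lemma bl_zero_umbrella : bl 0 umbrella = fun B => if B = ![3, 1] then 1 else 0 := by
  funext B
  unfold bl
  have hsum : Finset.sum (Finset.univ.erase (0 : Fin 2)) (fun j => B j) = B 1 := by
    have : (Finset.univ.erase (0 : Fin 2)) = {1} := by decide
    rw [this, Finset.sum_singleton]
  rw [hsum]
  by_cases hle : B 1 ≤ B 0
  · rw [if_pos hle]
    unfold umbrella
    have key : (Function.update B 0 (B 0 - B 1) = ![2, 1]) ↔ B = ![3, 1] := by
      constructor
      · intro h
        have h0 := congrFun h 0
        have h1 := congrFun h 1
        simp [Function.update] at h0 h1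
        funext j
        fin_cases j <;> simp <;> omega
      · intro h
        subst h
        funext j
        fin_cases j <;> simp [Function.update]
    by_cases hB : B = ![3, 1]
    · rw [if_pos (key.mpr hB), if_pos hB]
    · rw [if_neg (fun h => hB (key.mp h)), if_neg hB]
  · rw [if_neg hle]
    have hB : B ≠ ![3, 1] := by
      intro h; subst h; simp at hle
    rw [if_neg hB]

/-- Dividing `x³y` by `x²` gives `xy`. [folklore] -/
lemma dv_bl_zero_umbrella :
    dv 0 2 (bl 0 umbrella) = (fun A : Fin 2 → ℕ => if A = ![1, 1] then (1 : ZMod 2) else 0) := by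
  rw [bl_zero_umbrella]
  funext B
  unfold dv
  beta_reduce
  have key : (Function.update B 0 (B 0 + 2) = ![3, 1]) ↔ B = ![1, 1] := by
    constructor
    · intro h
      have h0 := congrFun h 0
      have h1 := congrFun h 1
      simp [Function.update] at h0 h1
      funext j
      fin_cases j <;> simp <;> omega
    · intro h
      subst h
      funext j
      fin_cases j <;> simp [Function.update]
  by_cases hB : B = ![1, 1]
  · rw [if_pos (key.mpr hB), if_pos hB]
  · rw [if_neg (fun h => hB (key.mp h)), if_neg hB]

/-- **The step**: one step in the `x`-chart at translation `0` maps the umbrella `x²y` (cleaned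
order `3 ≥ 2`, so the division is by `x²`) to `xy`. [folklore] -/
lemma step_zero_umbrella :
    step 2 0 (0 : Fin 2 → ZMod 2) umbrella = (fun A : Fin 2 → ℕ => if A = ![1, 1] then (1 : ZMod 2) else 0) := by
  unfold step
  rw [clean_umbrella, ord_umbrella, if_pos (by norm_num : 2 ≤ 3), dv_bl_zero_umbrella, tr_zero, clean_xy]

/-- Stage `1` of the run from `x²y` along the constant chart `x` and zero translations is `xy`. [folklore] -/
lemma run_one_umbrella :
    run 2 umbrella (fun _ => 0) (fun _ _ => 0) 1 = (fun A : Fin 2 → ℕ => if A = ![1, 1] then (1 : ZMod 2) else 0) := by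
  show step 2 0 (0 : Fin 2 → ZMod 2) umbrella = _
  exact step_zero_umbrella

/-! ## The Jacobian algebra of the umbrella is infinite over `κ` -/

/-- The Jacobian ideal `(∂(x²y)/∂x, ∂(x²y)/∂y) = (0, x²)` of the umbrella lies in `(x)`: every
generator has vanishing coefficients off the multiples of `x` (`MvPowerSeries.X_dvd_iff`). [folklore] -/
lemma jac_umbrella_le_span_X :
    jac 2 umbrella ≤ Ideal.span {(MvPowerSeries.X 0 : MvPowerSeries (Fin 2) (ZMod 2))} := by
  unfold jac
  rw [Ideal.span_le]
  rintro _ ⟨i, rfl⟩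
  rw [SetLike.mem_coe, Ideal.mem_span_singleton]
  refine MvPowerSeries.X_dvd_iff.mpr fun m hm => ?_
  change ((m i + 1 : ℕ) : ZMod 2) * clean 2 umbrella ((m + Finsupp.single i 1 : Fin 2 →₀ ℕ) : Fin 2 → ℕ) = 0
  rw [clean_umbrella]
  unfold umbrella
  rw [if_neg, mul_zero]
  intro h
  have h0 := congrFun h 0
  simp only [Finsupp.coe_add, Pi.add_apply, hm, Finsupp.single_apply, zero_add,
    Matrix.cons_val_zero] at h0
  split_ifs at h0
  omega

/-- **The umbrella is NOT isolated**: `κ[[x,y]] ⧸ (0, x²)` is infinite over `κ` — the classes of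
`1, y, y², …` are linearly independent (a relation would be a multiple of `x`, but `x ∣ f` kills the
coefficient of every `y^k`), so no finite `finrank` can bound them. [folklore] -/
lemma not_isol_umbrella :
    ¬ Module.Finite (ZMod 2) (MvPowerSeries (Fin 2) (ZMod 2) ⧸ jac 2 umbrella) := by
  intro hfin
  set R := MvPowerSeries (Fin 2) (ZMod 2) with hR
  set J : Ideal R := jac 2 umbrella with hJ
  set d := Module.finrank (ZMod 2) (R ⧸ J) with hd
  let v : Fin (d + 1) → R ⧸ J := fun k => Ideal.Quotient.mk J (MvPowerSeries.X 1 ^ (k : ℕ))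
  have hv : LinearIndependent (ZMod 2) v := by
    rw [Fintype.linearIndependent_iff]
    intro g hg k
    have hsum : Ideal.Quotient.mk J (∑ i : Fin (d + 1), MvPowerSeries.C (g i) * MvPowerSeries.X 1 ^ (i : ℕ)) =
        ∑ i : Fin (d + 1), g i • v i := by
      rw [map_sum]
      refine Finset.sum_congr rfl fun i _ => ?_
      rw [map_mul, MvPowerSeries.c_eq_algebraMap, Ideal.Quotient.mk_algebraMap, ← Algebra.smul_def]
    have hmem : (∑ i : Fin (d + 1), MvPowerSeries.C (g i) * MvPowerSeries.X 1 ^ (i : ℕ)) ∈ J := by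
      rw [← Ideal.Quotient.eq_zero_iff_mem, hsum, hg]
    have hdvd : (MvPowerSeries.X 0 : R) ∣ ∑ i : Fin (d + 1), MvPowerSeries.C (g i) * MvPowerSeries.X 1 ^ (i : ℕ) := by
      have := jac_umbrella_le_span_X hmem
      rwa [Ideal.mem_span_singleton] at this
    have hcoeff := (MvPowerSeries.X_dvd_iff.mp hdvd) (Finsupp.single 1 (k : ℕ)) (by simp)
    rw [map_sum] at hcoeff
    simp only [MvPowerSeries.coeff_C_mul, MvPowerSeries.coeff_X_pow] at hcoeff
    rw [Finset.sum_eq_single k] at hcoeff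
    · simpa using hcoeff
    · intro i _ hik
      rw [if_neg, mul_zero]
      intro h
      apply hik
      exact Fin.ext ((Finsupp.single_injective (1 : Fin 2)) h).symm
    · intro h
      exact absurd (Finset.mem_univ k) h
  have hle := hv.fintype_card_le_finrank
  rw [Fintype.card_fin] at hle
  omega

/-- … hence its `Module.finrank` is the junk value `0`. [folklore] -/
lemma finrank_umbrella :
    Module.finrank (ZMod 2) (MvPowerSeries (Fin 2) (ZMod 2) ⧸ jac 2 umbrella) = 0 :=
  Module.finrank_of_not_finite not_isol_umbrella

/-! ## The load-bearing lemma -/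

/-- **`Isol (run m)` is load-bearing in `IsolatedJacobianDrop`.** The proposition below is the
right-hand side of `crux_iff` (`FalseWithoutMultP.lean`) with the single hypothesis
`Module.Finite κ (MvPowerSeries (Fin n) κ ⧸ jac p (run p c₀ i t m))` (isolatedness at the EARLIER
stage) deleted and nothing else changed; it is false at
`(p, n, κ, c₀, i, t, m) = (2, 2, 𝔽₂, x²y, x-chart, 0, 0)`: the Whitney umbrella (multiplicity `2`,
NOT isolated, junk `finrank = 0`) has the ISOLATED multiplicity-`2` successor `xy` (`μ = 1`), and
`μ(xy) + Δ₂(2) ≤ 0` fails.  Any proof of the crux must use `Isol (run m)`. [folklore] -/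
theorem isolatedJacobianDrop_false_without_Isol :
    ¬ ∀ p : ℕ, p.Prime → ∀ n : ℕ, 0 < n → ∀ (κ : Type) [Field κ] [CharP κ p] [PerfectField κ]
        (c₀ : (Fin n → ℕ) → κ) (i : ℕ → Fin n) (t : ℕ → Fin n → κ),
        ∀ m, ((∃ A, clean p (run p c₀ i t m) A ≠ 0) ∧
            ∀ A, clean p (run p c₀ i t m) A ≠ 0 → p ≤ Finset.sum Finset.univ (fun j => A j)) →
          Module.Finite κ (MvPowerSeries (Fin n) κ ⧸ jac p (run p c₀ i t (m + 1))) →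
          ((∃ A, clean p (run p c₀ i t (m + 1)) A ≠ 0) ∧
            ∀ A, clean p (run p c₀ i t (m + 1)) A ≠ 0 → p ≤ Finset.sum Finset.univ (fun j => A j)) →
          Module.finrank κ (MvPowerSeries (Fin n) κ ⧸ jac p (run p c₀ i t (m + 1))) +
              ((p - 1) ^ n * (p + 1) + 1 - 2 * ((n + 1) % 2)) / p ≤
            Module.finrank κ (MvPowerSeries (Fin n) κ ⧸ jac p (run p c₀ i t m)) := by
  intro h
  haveI : PerfectField (ZMod 2) := PerfectField.ofFinite
  have key := h 2 Nat.prime_two 2 two_pos (ZMod 2) umbrella (fun _ => 0) (fun _ _ => 0) 0 multP_umbrella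
    (by rw [run_one_umbrella]; exact isol_xy) (by rw [run_one_umbrella]; exact multP_xy)
  rw [run_one_umbrella] at key
  have h0 : Module.finrank (ZMod 2) (MvPowerSeries (Fin 2) (ZMod 2) ⧸ jac 2 (run 2 umbrella (fun _ => 0) (fun _ _ => 0) 0)) = 0 :=
    finrank_umbrella
  rw [h0] at key
  norm_num at key

end Summit.ResolutionOfSingularities.ResolutionOfSingularities.Theorems.IsolatedJacobianDrop.Negative

end
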